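import Literature.LinearAlgebra.RootSystem.WeylGroupIsotropyGroups
import HarnessLib

/-!
# The reflection length of a Weyl group element is the codimension of its fixed space
# (Carter 1972 §2 Lemmas 2 and 3)

R. W. Carter, *Conjugacy classes in the Weyl group*, Compositio Math. **25** (1972) 1–59 (held text `paper:doi-10-1007-bfb0081548`, pp. 3–4 of
the paper), §2: "Now each element `w` in `W` can be expressed in the form `w = w_{r_1} w_{r_2} ⋯ w_{r_k}`, `r_i ∈ Φ`. We denote by `l̄(w)` the smallest
value of `k` in any such expression for `w`. LEMMA 2. `l̄(w)` is the number of eigenvalues of `w` on `V` which are not equal to `1`. In particular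
`l̄(w) ≤ l`. PROOF. Suppose `l̄(w) = k` … Then `w` fixes every vector in `U [= H_{r_1} ∩ ⋯ ∩ H_{r_k}]` and `dim U ≥ l - k`. … Conversely … `w`
fixes every vector in `V_1`, so is a product of reflections `w_r` fixing each vector in `V_1` [Lemma 1]. Thus all the roots `r` occurring are in
`V_1^⊥` … It is therefore sufficient to show that if `w` fixes no vector in `V` then `w` can be expressed as a product of at most `l` reflections.
Let `r ∈ Φ`. Since `w` fixes no vector, `w - 1` is non-singular. Thus there exists `v ∈ V` such that `(w - 1)v = r`. Thus `w(v) = v + r`. Now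
`(w(v), w(v)) = (v, v)`. Thus `(v + r, v + r) = (v, v)` and so `2(r, v)/(r, r) = -1`. It follows that `w_r(v) = v + r`. Hence `w(v) = w_r(v)` and
so `w_r w(v) = v`. By Lemma 1 `w_r w` is a product of reflections which all fix `v` so is contained in a Weyl group of smaller rank. By induction
`w_r w` is a product of at most `l - 1` reflections. … LEMMA 3. Let `r_1, r_2 ⋯ r_k ∈ Φ`. Then `w_{r_1} w_{r_2} ⋯ w_{r_k}` is reduced if and only
if `r_1, r_2 ⋯ r_k` are linearly independent."

THIS FILE (lane `lit-hodgefound`, prover seat p40, generation 38, row g38-#4; topic `Literature/LinearAlgebra/RootSystem`, namespace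
`Literature.LinearAlgebra.RootSystem(.Base)`) proves Lemma 2 and Lemma 3 for Mathlib's Weyl group `P.weylGroup ≤ Aut P` of a finite reduced
crystallographic root pairing `P : RootPairing ι K M N` over a field `K` of characteristic `0` (NO order), acting on a finite-dimensional weight
space `M`. "The number of eigenvalues not equal to `1`" is rendered as `dim (w - 1)V = dim V - dim V^w` (rank–nullity), the MOVED SPACE
`LinearMap.range (w|_V - 1)`; `l̄(w)` is not introduced as a function — the statements are "every expression of `w` as a product of reflections has
at least `dim (w - 1)V` factors" and "some expression has exactly `dim (w - 1)V` factors".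

PROOF ROUTE (Carter's, kept inside ONE root pairing). Lemma 1 is the tree's order-free Steinberg theorem (`WeylGroupIsotropyGroups`, g38-#3,
`exists_list_forall_smul_eq_self_prod_eq` ∕ `forall_smul_eq_self_iff_mem_closure_image_setOf_forall_coroot'_eq_zero`). Carter's Euclidean step
"the roots occurring are in `V_1^⊥ = (w - 1)V`" becomes §2: `α^∨` KILLS `V^w` IFF `α ∈ (w - 1)V`, proved without a form on the ambient space from
the averaging operator `Σ_{t < n} w^t` (`n` = order of `w`): `V^w = Σ_t w^t V`, `(w - 1)V = ker Σ_t w^t`, and `Σ_t (w^t α)^∨ = 0 ⟺ Σ_t w^t α = 0`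
through the canonical polarisation `M → N` (Mathlib `Polarization`, injective on `span Φ` in characteristic `0`). Carter's computation
`2(r, v)/(r, r) = -1` is done with Mathlib's canonical invariant form `P.toInvariantForm` (`RootForm`), which is `W`-invariant and anisotropic on
roots in characteristic `0` — no positivity needed. The induction runs on `dim (w - 1)V` inside `W` (instead of "a Weyl group of smaller rank"):
`w_r w` fixes `V^w ⊕ Kv` pointwise.

## What is proved (THEOREMS ONLY: no definition, no instance, no notation, no named fact; net debt 0)

* §1 **`toLinearMap_sub_id_apply`** ∕ **`mem_ker_sub_id_iff`** (bookkeeping: `(w - 1)x = wx - x`, `V^w = ker (w - 1)`),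
  **`prod_map_reflection_smul_sub_mem_span`** (`(w_{r_1} ⋯ w_{r_k} - 1)V ⊆ span{r_i}`), ★★ **`finrank_range_sub_id_le_length`** (LEMMA 2, FIRST HALF:
  every expression of `w` as a product of `k` reflections has `dim (w - 1)V ≤ k`), **`finrank_range_add_finrank_ker`** (`dim (w - 1)V + dim V^w = dim V`).
* §2 (averaging over `⟨w⟩`, `w^n = 1`) **`smul_sum_pow_smul_eq_of_pow_eq_one`** (`Σ_t w^t x ∈ V^w`), **`sub_pow_smul_mem_range_sub_id`** (`x - w^t x ∈
  (w - 1)V`), **`mem_range_sub_id_iff_sum_pow_smul_eq_zero`** (`x ∈ (w - 1)V ⟺ Σ_t w^t x = 0`), **`range_sub_id_inv`** (`(w⁻¹ - 1)V = (w - 1)V`),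
  **`two_mul_invariantForm_apply_root`** (`2B(x, α) = ⟨x, α^∨⟩ B(α, α)` for any invariant form), **`Base.exists_pow_eq_one`** (`w ∈ W` has finite
  order), ★★★ **`Base.root_mem_range_sub_id_iff_forall_coroot'_eq_zero`** ∕ ★★ **`Base.root_mem_range_sub_id_iff_forall_reflection_smul_eq`** (FOR
  `w ∈ W`: `α ∈ (w - 1)V ⟺ α^∨ KILLS V^w ⟺ s_α FIXES V^w` POINTWISE — Carter's "`V_1^⊥`" without a Euclidean structure).
* §3 ★ **`coroot'_eq_neg_one_of_smul_eq_add_root`** (CARTER'S COMPUTATION: `w ∈ W`, `wv = v + r` ⟹ `⟨v, r^∨⟩ = -1`, via the invariant form),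
  **`reflection_mul_smul_eq_self_of_smul_eq_add_root`** (then `w_r w (v) = v`).
* §4 ★★★ **`Base.exists_list_length_le_finrank_range_prod_eq`** (LEMMA 2, SECOND HALF: every `w ∈ W` is a product of at most `dim (w - 1)V`
  reflections), ★★★ **`Base.exists_list_length_eq_finrank_range_prod_eq`** (LEMMA 2: `l̄(w) = dim (w - 1)V`, attained), ★★
  **`Base.exists_list_length_add_finrank_ker_eq_prod_eq`** (Carter's wording `l̄(w) = l - dim V_1(w)`), ★ **`Base.exists_list_length_le_finrank_prod_eq`**
  («in particular `l̄(w) ≤ l`»).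
* §5 **`range_sub_id_le_span`** (`(w - 1)V ≤ span{r_i}` as submodules), ★★ **`linearIndependent_of_finrank_range_eq_length`** (LEMMA 3 ⟹: a reduced
  expression `w_{r_1} ⋯ w_{r_k}`, `k = dim (w - 1)V`, has linearly independent `r_1, …, r_k` — as a `Fin k`-indexed family, so repetitions are
  excluded), ★ **`nodup_of_finrank_range_eq_length`** (its indices are distinct), ★★ **`range_sub_id_eq_span_of_finrank_range_eq_length`** (then
  `(w - 1)V = span{r_i}`), ★★ **`Base.root_mem_range_sub_id_of_linearIndependent`** (LEMMA 3 ⟸, the heart: for linearly independent `r_1, …, r_k`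
  every `r_i ∈ (w - 1)V`), ★★ **`Base.finrank_range_sub_id_eq_length_of_linearIndependent`** (LEMMA 3 ⟸: then the expression is reduced), ★★★
  **`Base.finrank_range_sub_id_eq_length_iff_linearIndependent`** (LEMMA 3).

BY NAME, nothing restated: g38-#3 `Base.forall_smul_eq_self_iff_mem_closure_image_setOf_forall_coroot'_eq_zero` (Steinberg ∕ Carter Lemma 1),
`Base.exists_root'_ne_zero_of_mem_corootSpan` (`WeylGroupIsotropyGroups`); g36-#2 `Base.finite_weylGroup`; g36-#1 `coroot'_smul_smul`,
`smul_index_eq`, `prod_map_reflection_mem_weylGroup`, `reflection_smul_eq_self_iff`; Mathlib `RootPairing.toInvariantForm` ∕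
`InvariantForm.apply_weylGroup_smul` ∕ `InvariantForm.apply_reflection_reflection`, `rootForm_self_smul_coroot` ∕ `ker_polarization_eq_ker_rootForm` ∕
`disjoint_rootSpan_ker_rootForm`, `LinearMap.finrank_range_add_finrank_ker`, `Submodule.finrank_lt_finrank_of_lt`, `linearIndependent_finCons`,
`linearIndependent_iff_card_eq_finrank_span` ∕ `finrank_span_eq_card` ∕ `finrank_range_le_card`.

## Scope caveats

`M` is assumed finite-dimensional (`[Module.Finite K M]`) in §1's rank–nullity, in §4, and in §5 ⟸; "eigenvalues" are not mentioned — only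
`dim (w - 1)V` and `dim V^w` (for `w` of finite order over a field of characteristic `0` these agree with Carter's count, but that translation is not
made here). `l̄` is not defined as a function on `W`; "reduced" is spelt `dim (w - 1)V = k`. "`r_1, …, r_k` linearly independent" is the linear
independence of the `Fin k`-indexed family `j ↦ r_{i_j}` (Mathlib `LinearIndependent`), which excludes repeated roots, as Carter's usage requires.
Carter's Lemmas 4–5 (involutions) are in the sibling file `WeylGroupInvolutions` (g38-#1), proved independently of Lemma 2.

## References

* [Carter1972WeylConjugacy] R. W. Carter, *Conjugacy classes in the Weyl group*, Compositio Math. 25 (1972) 1–59 — §2, Lemmas 1–3.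
* [Humphreys1990] J. E. Humphreys, *Reflection Groups and Coxeter Groups*, CUP (1990) — §1.12 Theorem (d) (Steinberg's lemma).
-/

noncomputable section

open Module Set Function
open Submodule (span)

namespace Literature.LinearAlgebra.RootSystem

variable {ι K M N : Type*} [Field K] [CharZero K] [AddCommGroup M] [Module K M]
  [AddCommGroup N] [Module K N] [Fintype ι]
  {P : RootPairing ι K M N} [P.IsCrystallographic] [P.IsReduced]

/-! ## §1 Lemma 2, first half: `(s_{r_1} ⋯ s_{r_k} - 1)V ⊆ span{r_1, …, r_k}` has dimension `≤ k` -/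

section LowerBound

omit [CharZero K] [Fintype ι] [P.IsCrystallographic] [P.IsReduced] in
/-- The action of `w ∈ Aut P` on `V` as a linear map, minus the identity: `(w - 1)x = wx - x`. [cite: Carter1972WeylConjugacy, §2 Lemma 2 (proof: "w - 1")] -/
theorem toLinearMap_sub_id_apply (w : P.Aut) (x : M) : (DistribSMul.toLinearMap K M w - 1 : Module.End K M) x = w • x - x := rfl

omit [CharZero K] [Fintype ι] [P.IsCrystallographic] [P.IsReduced] in
/-- `x ∈ V^w` (the kernel of `w - 1`) iff `wx = x`. [cite: Carter1972WeylConjugacy, §2 Lemma 2 ("Let V_1 be the set of elements of V fixed by w")] -/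
theorem mem_ker_sub_id_iff (w : P.Aut) (x : M) : x ∈ LinearMap.ker (DistribSMul.toLinearMap K M w - 1) ↔ w • x = x := by
  rw [LinearMap.mem_ker, toLinearMap_sub_id_apply, sub_eq_zero]

omit [CharZero K] [Fintype ι] [P.IsCrystallographic] [P.IsReduced] in
/-- **`(s_{r_1} ⋯ s_{r_k})x - x ∈ span{r_1, …, r_k}`** for ANY roots `r_1, …, r_k` and any `x` (each reflection moves a vector by a multiple of its
root). [cite: Carter1972WeylConjugacy, §2 Lemma 3, proof ("every element of (w - 1)V would be a linear combination of s_1, s_2 ⋯ s_h")] -/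
theorem prod_map_reflection_smul_sub_mem_span (l : List ι) (x : M) :
    (l.map (RootPairing.Equiv.reflection P)).prod • x - x ∈ span K (P.root '' {i | i ∈ l}) := by
  induction l generalizing x with
  | nil => simp
  | cons a l ih =>
    rw [List.map_cons, List.prod_cons, mul_smul]
    have h1 : RootPairing.Equiv.reflection P a • ((l.map (RootPairing.Equiv.reflection P)).prod • x) - x =
        (RootPairing.Equiv.reflection P a • ((l.map (RootPairing.Equiv.reflection P)).prod • x) -
          (l.map (RootPairing.Equiv.reflection P)).prod • x) + ((l.map (RootPairing.Equiv.reflection P)).prod • x - x) := by abel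
    rw [h1]
    refine Submodule.add_mem _ ?_ (Submodule.span_mono (Set.image_mono fun i hi ↦ List.mem_cons_of_mem a hi) (ih x))
    rw [RootPairing.Equiv.reflection_smul, RootPairing.reflection_apply, sub_sub_cancel_left, Submodule.neg_mem_iff]
    exact Submodule.smul_mem _ _ (Submodule.subset_span ⟨a, List.mem_cons_self, rfl⟩)

omit [CharZero K] [Fintype ι] [P.IsCrystallographic] [P.IsReduced] in
/-- ★★ **CARTER LEMMA 2, FIRST HALF: if `w = s_{r_1} ⋯ s_{r_k}` then `dim (w - 1)V ≤ k`** («`w` fixes every vector in `U = ⋂ H_{r_i}` and `dim U ≥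
l - k`», here as `(w - 1)V ⊆ span{r_i}`). [cite: Carter1972WeylConjugacy, §2 Lemma 2 (proof, first paragraph)] -/
theorem finrank_range_sub_id_le_length (l : List ι) :
    Module.finrank K (LinearMap.range (DistribSMul.toLinearMap K M (l.map (RootPairing.Equiv.reflection P)).prod - 1)) ≤
      l.length := by
  classical
  have hle : LinearMap.range (DistribSMul.toLinearMap K M (l.map (RootPairing.Equiv.reflection P)).prod - 1) ≤
      span K ((l.toFinset.image P.root : Finset M) : Set M) := by
    rintro _ ⟨x, rfl⟩
    rw [toLinearMap_sub_id_apply (P := P)]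
    have h := prod_map_reflection_smul_sub_mem_span (P := P) l x
    refine Submodule.span_mono (fun y hy ↦ ?_) h
    obtain ⟨i, hi, rfl⟩ := hy
    exact Finset.mem_coe.mpr (Finset.mem_image.mpr ⟨i, List.mem_toFinset.mpr hi, rfl⟩)
  refine (Submodule.finrank_mono hle).trans ((finrank_span_finset_le_card _).trans ?_)
  exact Finset.card_image_le.trans (List.toFinset_card_le l)

omit [CharZero K] [Fintype ι] [P.IsCrystallographic] [P.IsReduced] in
/-- Rank–nullity for the action of `w`: **`dim (w - 1)V + dim V^w = dim V`** (so `dim (w - 1)V` is «the number of eigenvalues of `w` which are not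
equal to `1`», counted as the codimension of the fixed space). [cite: Carter1972WeylConjugacy, §2 Lemma 2 ("dim V_1 = l - k and dim V_1^⊥ = k")] -/
theorem finrank_range_add_finrank_ker [Module.Finite K M] (w : P.Aut) :
    Module.finrank K (LinearMap.range (DistribSMul.toLinearMap K M w - 1)) +
      Module.finrank K (LinearMap.ker (DistribSMul.toLinearMap K M w - 1)) = Module.finrank K M :=
  LinearMap.finrank_range_add_finrank_ker _

end LowerBound

/-! ## §2 Averaging over `⟨w⟩`: `α ∈ (w - 1)V` iff `α^∨` kills `V^w` -/

section Averaging

omit [CharZero K] [Fintype ι] [P.IsCrystallographic] [P.IsReduced] in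
/-- For `w^n = 1`: **`Σ_{t<n} w^t x` is fixed by `w`**. [cite: Carter1972WeylConjugacy, §2 Lemma 2 (V_1 ⊕ V_1^⊥)] -/
theorem smul_sum_pow_smul_eq_of_pow_eq_one {w : P.Aut} {n : ℕ} (hn : w ^ n = 1) (x : M) :
    w • ∑ t ∈ Finset.range n, (w ^ t) • x = ∑ t ∈ Finset.range n, (w ^ t) • x := by
  rw [Finset.smul_sum]
  simp_rw [smul_smul, ← pow_succ']
  have h1 := Finset.sum_range_succ' (fun t ↦ (w ^ t) • x) n
  have h2 := Finset.sum_range_succ (fun t ↦ (w ^ t) • x) n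
  simp only [pow_zero, hn, one_smul] at h1 h2
  exact add_right_cancel (h1.symm.trans h2)

omit [CharZero K] [Fintype ι] [P.IsCrystallographic] [P.IsReduced] in
/-- `(w - 1)V` is stable under the powers of `w`: **`x - w^t x ∈ (w - 1)V`**. [cite: Carter1972WeylConjugacy, §2 Lemma 2] -/
theorem sub_pow_smul_mem_range_sub_id (w : P.Aut) (t : ℕ) (x : M) :
    x - (w ^ t) • x ∈ LinearMap.range (DistribSMul.toLinearMap K M w - 1) := by
  induction t with
  | zero => simp
  | succ t ih =>
    have h1 : x - (w ^ (t + 1)) • x = (x - (w ^ t) • x) - (w • ((w ^ t) • x) - (w ^ t) • x) := by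
      rw [smul_smul, ← pow_succ']; abel
    rw [h1]
    exact Submodule.sub_mem _ ih ⟨(w ^ t) • x, rfl⟩

omit [Fintype ι] [P.IsCrystallographic] [P.IsReduced] in
/-- For `w^n = 1`, `n ≠ 0`: **`x ∈ (w - 1)V ⟺ Σ_{t<n} w^t x = 0`** (`Σ_t w^t (w - 1) = w^n - 1 = 0`; conversely `n x = Σ_t (x - w^t x)` and
`1 - w^t = (1 - w)(1 + w + ⋯ + w^{t-1})`). [cite: Carter1972WeylConjugacy, §2 Lemma 2 (V = V_1 ⊕ V_1^⊥)] -/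
theorem mem_range_sub_id_iff_sum_pow_smul_eq_zero {w : P.Aut} {n : ℕ} (hn : w ^ n = 1) (hn0 : n ≠ 0) (x : M) :
    x ∈ LinearMap.range (DistribSMul.toLinearMap K M w - 1) ↔ ∑ t ∈ Finset.range n, (w ^ t) • x = 0 := by
  constructor
  · rintro ⟨y, rfl⟩
    rw [toLinearMap_sub_id_apply (P := P)]
    have h1 : ∀ t ∈ Finset.range n, (w ^ t) • (w • y - y) = (w ^ (t + 1)) • y - (w ^ t) • y := fun t _ ↦ by
      rw [smul_sub, smul_smul, ← pow_succ]
    rw [Finset.sum_congr rfl h1, Finset.sum_range_sub (fun t ↦ (w ^ t) • y), hn, pow_zero, sub_self]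
  · intro hx
    have h1 : ∑ t ∈ Finset.range n, (x - (w ^ t) • x) ∈ LinearMap.range (DistribSMul.toLinearMap K M w - 1) :=
      Submodule.sum_mem _ fun t _ ↦ sub_pow_smul_mem_range_sub_id w t x
    rw [Finset.sum_sub_distrib, hx, sub_zero, Finset.sum_const, Finset.card_range, ← Nat.cast_smul_eq_nsmul K] at h1
    exact (Submodule.smul_mem_iff _ (Nat.cast_ne_zero.mpr hn0)).mp h1

omit [CharZero K] [Fintype ι] [P.IsCrystallographic] [P.IsReduced] in
/-- `(w⁻¹ - 1)V = (w - 1)V`. [cite: Carter1972WeylConjugacy, §2 Lemma 2] -/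
theorem range_sub_id_inv (w : P.Aut) :
    LinearMap.range (DistribSMul.toLinearMap K M w⁻¹ - 1) = LinearMap.range (DistribSMul.toLinearMap K M w - 1) := by
  have key : ∀ g : P.Aut, LinearMap.range (DistribSMul.toLinearMap K M g⁻¹ - 1) ≤
      LinearMap.range (DistribSMul.toLinearMap K M g - 1) := by
    rintro g _ ⟨x, rfl⟩
    refine ⟨-(g⁻¹ • x), ?_⟩
    rw [toLinearMap_sub_id_apply, toLinearMap_sub_id_apply, smul_neg, smul_inv_smul]
    abel
  refine le_antisymm (key w) ?_
  have h := key w⁻¹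
  rwa [inv_inv] at h

omit [CharZero K] [Fintype ι] [P.IsCrystallographic] [P.IsReduced] in
/-- **`2 B(x, α) = ⟨x, α^∨⟩ B(α, α)`** for every invariant form `B` and every `x` (invariance under `s_α`). [cite: Carter1972WeylConjugacy, §2 Lemma 2 (proof: "2(r, v)/(r, r)")] -/
theorem two_mul_invariantForm_apply_root (B : P.InvariantForm) (x : M) (i : ι) :
    2 * B.form x (P.root i) = P.coroot' i x * B.form (P.root i) (P.root i) := by
  have h := B.apply_reflection_reflection i x (P.root i)
  rw [RootPairing.reflection_apply_self, RootPairing.reflection_apply, map_neg, map_sub, map_smul, LinearMap.sub_apply,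
    LinearMap.smul_apply, smul_eq_mul] at h
  linear_combination -h

namespace Base

variable (b : P.Base)

include b in
/-- An element of the (finite) Weyl group has finite order: `w^n = 1` for some `n ≥ 1`. [cite: Humphreys1990, §1.4 ("W is finite")] -/
theorem exists_pow_eq_one {w : P.Aut} (hw : w ∈ P.weylGroup) : ∃ n : ℕ, n ≠ 0 ∧ w ^ n = 1 := by
  haveI := finite_weylGroup b
  have h := isOfFinOrder_of_finite (⟨w, hw⟩ : P.weylGroup)
  refine ⟨orderOf (⟨w, hw⟩ : P.weylGroup), (orderOf_pos_iff.mpr h).ne', ?_⟩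
  have h1 := pow_orderOf_eq_one (⟨w, hw⟩ : P.weylGroup)
  exact congrArg Subtype.val h1

include b in
/-- ★★★ **FOR `w ∈ W`, A ROOT `α` LIES IN THE MOVED SPACE `(w - 1)V` IFF ITS CO-ROOT KILLS THE FIXED SPACE `V^w`** (iff `s_α` fixes `V^w` pointwise)
— Carter's «the roots occurring are in `V_1^⊥`», without a Euclidean structure: ⟹ by the invariant form; ⟸ by averaging over `⟨w⟩`: `V^w ∋ Σ_t w^t x`
gives `⟨x, Σ_t (w^{-t}α)^∨⟩ = 0` for all `x`, so `Σ_t (w^{-t}α)^∨ = 0`, whence (canonical polarisation, `‖w^{-t}α‖ = ‖α‖`) `Σ_t w^{-t}α = 0`, i.e.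
`α ∈ (w⁻¹ - 1)V = (w - 1)V`. [cite: Carter1972WeylConjugacy, §2 Lemma 2 (proof: "w … is a product of reflections w_r fixing each vector in V_1. Thus all the roots r occurring are in V_1^⊥")] -/
theorem root_mem_range_sub_id_iff_forall_coroot'_eq_zero {w : P.Aut} (hw : w ∈ P.weylGroup) (i : ι) :
    P.root i ∈ LinearMap.range (DistribSMul.toLinearMap K M w - 1) ↔ ∀ x : M, w • x = x → P.coroot' i x = 0 := by
  classical
  constructor
  · rintro ⟨y, hy⟩ x hx
    rw [toLinearMap_sub_id_apply (P := P)] at hy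
    -- `2 B(x, α) = ⟨x, α^∨⟩ B(α, α)` and `B(x, wy - y) = B(w⁻¹x, y) - B(x, y) = 0`
    have h1 := two_mul_invariantForm_apply_root P.toInvariantForm x i
    have h2 : P.toInvariantForm.form x (P.root i) = 0 := by
      rw [← hy, map_sub]
      have h3 : P.toInvariantForm.form x (w • y) = P.toInvariantForm.form x y := by
        have h4 := RootPairing.InvariantForm.apply_weylGroup_smul P (B := P.toInvariantForm) (⟨w, hw⟩ : P.weylGroup) (w⁻¹ • x) y
        rw [show ((⟨w, hw⟩ : P.weylGroup) • (w⁻¹ • x) : M) = w • (w⁻¹ • x) from rfl, smul_inv_smul,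
          show ((⟨w, hw⟩ : P.weylGroup) • y : M) = w • y from rfl] at h4
        rw [h4]
        have hx' : w⁻¹ • x = x := by rw [← hx, inv_smul_smul, hx]
        rw [hx']
      rw [h3, sub_self]
    rw [h2, mul_zero] at h1
    exact (mul_eq_zero.mp h1.symm).resolve_right (P.toInvariantForm.ne_zero i)
  · intro h
    obtain ⟨n, hn0, hn⟩ := exists_pow_eq_one b hw
    -- the co-root-lattice vector `z = Σ_t (w^{-t} α)^∨` pairs to zero with everything, hence vanishes
    set z : N := ∑ t ∈ Finset.range n, P.coroot ((w ^ t)⁻¹ • i) with hzdef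
    have hz_pair : ∀ x : M, P.toLinearMap x z = 0 := fun x ↦ by
      have h1 := h _ (smul_sum_pow_smul_eq_of_pow_eq_one hn x)
      rw [map_sum] at h1
      rw [hzdef, map_sum, ← h1]
      refine Finset.sum_congr rfl fun t _ ↦ ?_
      rw [← coroot'_smul_smul (w ^ t)⁻¹ i ((w ^ t) • x), inv_smul_smul]
      rfl
    have hz : z = 0 := by
      by_contra hne
      have hz_mem : z ∈ P.corootSpan K := Submodule.sum_mem _ fun t _ ↦ Submodule.subset_span ⟨_, rfl⟩
      obtain ⟨k, hk⟩ := exists_root'_ne_zero_of_mem_corootSpan hz_mem hne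
      exact hk (hz_pair (P.root k))
    -- `S = Σ_t w^{-t} α` has polarisation `(B(α,α)/2) z = 0`, hence vanishes
    set S : M := ∑ t ∈ Finset.range n, (w ^ t)⁻¹ • P.root i with hSdef
    have hB : ∀ t, P.RootForm (P.root ((w ^ t)⁻¹ • i)) (P.root ((w ^ t)⁻¹ • i)) = P.RootForm (P.root i) (P.root i) := fun t ↦ by
      rw [smul_index_eq, RootPairing.Equiv.root_indexEquiv_eq_smul]
      have hmem : (w ^ t)⁻¹ ∈ P.weylGroup := inv_mem (pow_mem hw t)
      exact RootPairing.InvariantForm.apply_weylGroup_smul P (B := P.toInvariantForm) (⟨(w ^ t)⁻¹, hmem⟩ : P.weylGroup) (P.root i) (P.root i)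
    have hS_pol : (2 : K) • P.Polarization S = 0 := by
      rw [hSdef, map_sum, Finset.smul_sum]
      have h1 : ∀ t ∈ Finset.range n, (2 : K) • P.Polarization ((w ^ t)⁻¹ • P.root i) =
          P.RootForm (P.root i) (P.root i) • P.coroot ((w ^ t)⁻¹ • i) := fun t _ ↦ by
        rw [← RootPairing.Equiv.root_indexEquiv_eq_smul, ← smul_index_eq, two_smul, ← two_nsmul, ← P.rootForm_self_smul_coroot, hB]
      rw [Finset.sum_congr rfl h1, ← Finset.smul_sum, ← hzdef, hz, smul_zero]
    have hS_ker : S ∈ LinearMap.ker P.RootForm := by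
      rw [← P.ker_polarization_eq_ker_rootForm, LinearMap.mem_ker]
      exact (smul_eq_zero.mp hS_pol).resolve_left two_ne_zero
    have hS_mem : S ∈ P.rootSpan K := Submodule.sum_mem _ fun t _ ↦ by
      rw [← RootPairing.Equiv.root_indexEquiv_eq_smul]
      exact Submodule.subset_span ⟨_, rfl⟩
    have hS : S = 0 := (Submodule.disjoint_def.mp P.disjoint_rootSpan_ker_rootForm) S hS_mem hS_ker
    -- hence `α ∈ (w⁻¹ - 1)V = (w - 1)V`
    rw [← range_sub_id_inv, mem_range_sub_id_iff_sum_pow_smul_eq_zero (by rw [inv_pow, hn, inv_one]) hn0]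
    rw [← hS, hSdef]
    exact Finset.sum_congr rfl fun t _ ↦ by rw [inv_pow]

include b in
/-- ★★ The same in terms of the reflection: **`α ∈ (w - 1)V` iff `s_α` fixes `V^w` pointwise** (`w ∈ W`). [cite: Carter1972WeylConjugacy, §2 Lemma 2 (proof)] -/
theorem root_mem_range_sub_id_iff_forall_reflection_smul_eq {w : P.Aut} (hw : w ∈ P.weylGroup) (i : ι) :
    P.root i ∈ LinearMap.range (DistribSMul.toLinearMap K M w - 1) ↔
      ∀ x : M, w • x = x → RootPairing.Equiv.reflection P i • x = x := by
  rw [root_mem_range_sub_id_iff_forall_coroot'_eq_zero b hw]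
  simp only [reflection_smul_eq_self_iff]

end Base

end Averaging

/-! ## §3 Carter's computation: `wv = v + r` forces `⟨v, r^∨⟩ = -1`, so `w_r w` fixes `v` -/

section Trick

omit [P.IsReduced] in
/-- ★ **CARTER'S COMPUTATION**: if `w ∈ W` and `wv = v + r` for a root `r`, then `⟨v, r^∨⟩ = -1` («`(w(v), w(v)) = (v, v)`. Thus
`(v + r, v + r) = (v, v)` and so `2(r, v)/(r, r) = -1» — with Mathlib's canonical invariant form `RootForm`, `W`-invariant and non-zero on
roots in characteristic `0`). [cite: Carter1972WeylConjugacy, §2 Lemma 2 (proof)] -/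
theorem coroot'_eq_neg_one_of_smul_eq_add_root {w : P.Aut} (hw : w ∈ P.weylGroup) {v : M} {i : ι} (h : w • v = v + P.root i) :
    P.coroot' i v = -1 := by
  have h1 := RootPairing.InvariantForm.apply_weylGroup_smul P (B := P.toInvariantForm) (⟨w, hw⟩ : P.weylGroup) v v
  rw [show ((⟨w, hw⟩ : P.weylGroup) • v : M) = w • v from rfl, h] at h1
  simp only [map_add, LinearMap.add_apply] at h1
  have h2 := two_mul_invariantForm_apply_root P.toInvariantForm v i
  have h3 : P.toInvariantForm.form (P.root i) v = P.toInvariantForm.form v (P.root i) := by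
    rw [← P.toInvariantForm.symm.eq v (P.root i), RingHom.id_apply]
  rw [h3] at h1
  -- `h1 : B(v,v) + B(v,r) + (B(v,r) + B(r,r)) = B(v,v)`, `h2 : 2 B(v,r) = ⟨v,r^∨⟩ B(r,r)`
  have h4 : (P.coroot' i v + 1) * P.toInvariantForm.form (P.root i) (P.root i) = 0 := by linear_combination h1 - h2
  rcases mul_eq_zero.mp h4 with h5 | h5
  · linear_combination h5
  · exact absurd h5 (P.toInvariantForm.ne_zero i)

omit [CharZero K] [Fintype ι] [P.IsCrystallographic] [P.IsReduced] in
/-- «It follows that `w_r(v) = v + r`. Hence `w(v) = w_r(v)` and so `w_r w(v) = v`.» [cite: Carter1972WeylConjugacy, §2 Lemma 2 (proof)] -/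
theorem reflection_mul_smul_eq_self_of_smul_eq_add_root {w : P.Aut} {v : M} {i : ι} (h : w • v = v + P.root i)
    (hv : P.coroot' i v = -1) : (RootPairing.Equiv.reflection P i * w) • v = v := by
  rw [mul_smul, h, smul_add, RootPairing.Equiv.reflection_smul, RootPairing.Equiv.reflection_smul, RootPairing.reflection_apply, hv,
    RootPairing.reflection_apply_self, neg_one_smul, sub_neg_eq_add, add_neg_cancel_right]

end Trick

/-! ## §4 Carter's Lemma 2: every `w ∈ W` is a product of exactly `dim (w - 1)V` reflections -/

section Lemma2

namespace Base

variable (b : P.Base)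

include b in
/-- ★★★ **CARTER 1972 §2 LEMMA 2, SECOND HALF: EVERY `w ∈ W` IS A PRODUCT OF AT MOST `dim (w - 1)V` REFLECTIONS** (`V` finite-dimensional).
Induction on `dim (w - 1)V`: for `w ≠ 1`, Steinberg's lemma (tree, order-free) gives a root `r` whose co-root kills `V^w`, so `r ∈ (w - 1)V` (§2),
`r = wv - v`; then `⟨v, r^∨⟩ = -1` (§3), `w_r w` fixes `V^w ⊕ Kv` pointwise, and `dim (w_r w - 1)V < dim (w - 1)V`.
[cite: Carter1972WeylConjugacy, §2 Lemma 2 ("w is a product of at most k reflections and l̄(w) ≤ k")] -/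
theorem exists_list_length_le_finrank_range_prod_eq [Module.Finite K M] {w : P.Aut} (hw : w ∈ P.weylGroup) :
    ∃ l : List ι, l.length ≤ Module.finrank K (LinearMap.range (DistribSMul.toLinearMap K M w - 1)) ∧
      (l.map (RootPairing.Equiv.reflection P)).prod = w := by
  classical
  suffices h : ∀ k : ℕ, ∀ w ∈ P.weylGroup, Module.finrank K (LinearMap.range (DistribSMul.toLinearMap K M w - 1)) = k →
      ∃ l : List ι, l.length ≤ k ∧ (l.map (RootPairing.Equiv.reflection P)).prod = w by
    exact h _ w hw rfl
  intro k
  induction k using Nat.strong_induction_on with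
  | _ k ih =>
    intro w hw hk
    by_cases h1 : w = 1
    · exact ⟨[], Nat.zero_le _, by rw [h1]; rfl⟩
    -- Steinberg: `w ∈ ⟨s_α : α^∨ kills V^w⟩`; since `w ≠ 1` some such `α` exists
    have hmem := (forall_smul_eq_self_iff_mem_closure_image_setOf_forall_coroot'_eq_zero b {x : M | w • x = x} hw).mp fun u hu ↦ hu
    obtain ⟨i, hi⟩ : ∃ i : ι, ∀ u ∈ {x : M | w • x = x}, P.coroot' i u = 0 := by
      by_contra! hnone
      have hempty : {i : ι | ∀ u ∈ {x : M | w • x = x}, P.coroot' i u = 0} = ∅ :=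
        Set.eq_empty_of_forall_notMem fun i hi' ↦ by
          obtain ⟨u, hu, hne⟩ := hnone i
          exact hne (hi' u hu)
      rw [hempty, Set.image_empty, Subgroup.closure_empty, Subgroup.mem_bot] at hmem
      exact h1 hmem
    -- `r = α_i ∈ (w - 1)V`: `r = wv - v`
    obtain ⟨v, hv⟩ := (root_mem_range_sub_id_iff_forall_coroot'_eq_zero b hw i).mpr fun x hx ↦ hi x hx
    rw [toLinearMap_sub_id_apply (P := P)] at hv
    have hwv : w • v = v + P.root i := by rw [← hv]; abel
    have hcv := coroot'_eq_neg_one_of_smul_eq_add_root hw hwv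
    -- `w' = s_r w` fixes `V^w` and `v ∉ V^w`
    set w' := RootPairing.Equiv.reflection P i * w with hw'def
    have hw' : w' ∈ P.weylGroup := mul_mem (RootPairing.reflection_mem_weylGroup P i) hw
    have hfix : LinearMap.ker (DistribSMul.toLinearMap K M w - 1) < LinearMap.ker (DistribSMul.toLinearMap K M w' - 1) := by
      refine lt_of_le_of_ne (fun u hu ↦ ?_) fun heq ↦ ?_
      · rw [mem_ker_sub_id_iff] at hu ⊢
        rw [hw'def, mul_smul, hu, RootPairing.Equiv.reflection_smul, RootPairing.reflection_apply, hi u hu, zero_smul, sub_zero]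
      · have hv' : v ∈ LinearMap.ker (DistribSMul.toLinearMap K M w' - 1) := by
          rw [mem_ker_sub_id_iff, hw'def]
          exact reflection_mul_smul_eq_self_of_smul_eq_add_root hwv hcv
        rw [← heq, mem_ker_sub_id_iff, hwv, add_eq_left] at hv'
        exact P.ne_zero i hv'
    have hlt : Module.finrank K (LinearMap.range (DistribSMul.toLinearMap K M w' - 1)) < k := by
      have h2 := Submodule.finrank_lt_finrank_of_lt hfix
      have h3 := finrank_range_add_finrank_ker (K := K) (M := M) w
      have h4 := finrank_range_add_finrank_ker (K := K) (M := M) w'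
      omega
    obtain ⟨l', hl', hprod'⟩ := ih _ hlt w' hw' rfl
    refine ⟨i :: l', by rw [List.length_cons]; omega, ?_⟩
    have hss : RootPairing.Equiv.reflection P i * RootPairing.Equiv.reflection P i = 1 := by
      rw [mul_eq_one_iff_eq_inv, RootPairing.Equiv.reflection_inv]
    rw [List.map_cons, List.prod_cons, hprod', hw'def, ← mul_assoc, hss, one_mul]

include b in
/-- ★★★ **CARTER 1972 §2 LEMMA 2: `l̄(w) = dim (w - 1)V`** — every `w ∈ W` is a product of EXACTLY `dim (w - 1)V` reflections (and of no fewer, §1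
`finrank_range_sub_id_le_length`). [cite: Carter1972WeylConjugacy, §2 Lemma 2 ("l̄(w) is the number of eigenvalues of w on V which are not equal to 1")] -/
theorem exists_list_length_eq_finrank_range_prod_eq [Module.Finite K M] {w : P.Aut} (hw : w ∈ P.weylGroup) :
    ∃ l : List ι, l.length = Module.finrank K (LinearMap.range (DistribSMul.toLinearMap K M w - 1)) ∧
      (l.map (RootPairing.Equiv.reflection P)).prod = w := by
  obtain ⟨l, hl, hprod⟩ := exists_list_length_le_finrank_range_prod_eq b hw
  refine ⟨l, le_antisymm hl ?_, hprod⟩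
  rw [← hprod]
  exact finrank_range_sub_id_le_length l

include b in
/-- ★★ Carter's wording **`l̄(w) = l - dim V_1(w)`**: some expression of `w ∈ W` as a product of reflections has `k` factors with `k + dim V^w = dim V`.
[cite: Carter1972WeylConjugacy, §2 Lemma 2 and its Corollary ("l̄(w) = l - dim V_1(w)")] -/
theorem exists_list_length_add_finrank_ker_eq_prod_eq [Module.Finite K M] {w : P.Aut} (hw : w ∈ P.weylGroup) :
    ∃ l : List ι, l.length + Module.finrank K (LinearMap.ker (DistribSMul.toLinearMap K M w - 1)) = Module.finrank K M ∧
      (l.map (RootPairing.Equiv.reflection P)).prod = w := by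
  obtain ⟨l, hl, hprod⟩ := exists_list_length_eq_finrank_range_prod_eq b hw
  exact ⟨l, by rw [hl, finrank_range_add_finrank_ker], hprod⟩

include b in
/-- ★ «In particular `l̄(w) ≤ l`»: every `w ∈ W` is a product of at most `dim V` reflections. [cite: Carter1972WeylConjugacy, §2 Lemma 2 ("In particular l̄(w) ≤ l")] -/
theorem exists_list_length_le_finrank_prod_eq [Module.Finite K M] {w : P.Aut} (hw : w ∈ P.weylGroup) :
    ∃ l : List ι, l.length ≤ Module.finrank K M ∧ (l.map (RootPairing.Equiv.reflection P)).prod = w := by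
  obtain ⟨l, hl, hprod⟩ := exists_list_length_add_finrank_ker_eq_prod_eq b hw
  exact ⟨l, by omega, hprod⟩

end Base

end Lemma2

/-! ## §5 Carter's Lemma 3: `w_{r_1} ⋯ w_{r_k}` is reduced iff `r_1, …, r_k` are linearly independent -/

section Lemma3

omit [Field K] [CharZero K] [AddCommGroup M] [Module K M] [AddCommGroup N] [Module K N] [Fintype ι] [P.IsCrystallographic] [P.IsReduced] in
/-- The roots `r_1, …, r_k` of a word `(i_1, …, i_k)`, as a set: `{r_j} = root '' {i | i ∈ l}` (private plumbing). [folklore] -/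
private theorem range_root_getElem_eq_image {K M N : Type*} [CommRing K] [AddCommGroup M] [Module K M] [AddCommGroup N] [Module K N]
    {P : RootPairing ι K M N} (l : List ι) : Set.range (fun j : Fin l.length ↦ P.root l[j]) = P.root '' {i | i ∈ l} := by
  rw [← Set.range_list_get, ← Set.range_comp]
  rfl

omit [CharZero K] [Fintype ι] [P.IsCrystallographic] [P.IsReduced] in
/-- `(w - 1)V ⊆ span{r_1, …, r_k}` for `w = w_{r_1} ⋯ w_{r_k}`, submodule form of §1. [cite: Carter1972WeylConjugacy, §2 Lemma 2 (proof: "(w - 1)V is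
contained in the subspace spanned by r_1, r_2, ⋯, r_k")] -/
theorem range_sub_id_le_span (l : List ι) :
    LinearMap.range (DistribSMul.toLinearMap K M (l.map (RootPairing.Equiv.reflection P)).prod - 1) ≤ span K (P.root '' {i | i ∈ l}) := by
  rintro _ ⟨x, rfl⟩
  rw [toLinearMap_sub_id_apply (P := P)]
  exact prod_map_reflection_smul_sub_mem_span l x

omit [CharZero K] [Fintype ι] [P.IsCrystallographic] [P.IsReduced] in
/-- ★★ **CARTER LEMMA 3, ⟹: a reduced expression `w = w_{r_1} ⋯ w_{r_k}` (`k = dim (w - 1)V`) has linearly independent roots `r_1, …, r_k`**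
(`k = dim (w - 1)V ≤ dim span{r_j} ≤ k`). [cite: Carter1972WeylConjugacy, §2 Lemma 3 ("Suppose the expression is reduced. Then w has k eigenvalues not equal to 1 … It follows that r_1, r_2 ⋯ r_k are linearly independent")] -/
theorem linearIndependent_of_finrank_range_eq_length (l : List ι)
    (h : Module.finrank K (LinearMap.range (DistribSMul.toLinearMap K M (l.map (RootPairing.Equiv.reflection P)).prod - 1)) = l.length) :
    LinearIndependent K (fun j : Fin l.length ↦ P.root l[j]) := by
  rw [linearIndependent_iff_card_eq_finrank_span, Fintype.card_fin, Set.finrank]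
  refine le_antisymm ?_ ?_
  · haveI := Module.Finite.span_of_finite K ((List.finite_toSet l).image P.root)
    rw [range_root_getElem_eq_image]
    exact h.symm.le.trans (Submodule.finrank_mono (range_sub_id_le_span l))
  · have h1 := finrank_range_le_card (R := K) (fun j : Fin l.length ↦ P.root l[j])
    rwa [Fintype.card_fin] at h1

omit [CharZero K] [Fintype ι] [P.IsCrystallographic] [P.IsReduced] in
/-- ★ In particular **the roots of a reduced expression are distinct**. [cite: Carter1972WeylConjugacy, §2 Lemma 3] -/
theorem nodup_of_finrank_range_eq_length (l : List ι)
    (h : Module.finrank K (LinearMap.range (DistribSMul.toLinearMap K M (l.map (RootPairing.Equiv.reflection P)).prod - 1)) = l.length) :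
    l.Nodup :=
  List.nodup_iff_injective_get.mpr (Function.Injective.of_comp (f := P.root) (linearIndependent_of_finrank_range_eq_length l h).injective)

omit [CharZero K] [Fintype ι] [P.IsCrystallographic] [P.IsReduced] in
/-- ★★ For a reduced expression, **`(w - 1)V = span{r_1, …, r_k}`**. [cite: Carter1972WeylConjugacy, §2 Lemma 3 (proof: "Since (w - 1)V = (w' - 1)V and
this subspace is spanned by …")] -/
theorem range_sub_id_eq_span_of_finrank_range_eq_length [Module.Finite K M] (l : List ι)
    (h : Module.finrank K (LinearMap.range (DistribSMul.toLinearMap K M (l.map (RootPairing.Equiv.reflection P)).prod - 1)) = l.length) :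
    LinearMap.range (DistribSMul.toLinearMap K M (l.map (RootPairing.Equiv.reflection P)).prod - 1) = span K (P.root '' {i | i ∈ l}) := by
  refine Submodule.eq_of_le_of_finrank_le (range_sub_id_le_span l) ?_
  rw [← range_root_getElem_eq_image, finrank_span_eq_card (linearIndependent_of_finrank_range_eq_length l h), Fintype.card_fin, h]

namespace Base

variable (b : P.Base)

include b in
/-- ★★ **CARTER LEMMA 3, ⟸: for linearly independent roots `r_1, …, r_k`, every `r_i` lies in `(w - 1)V`, `w = w_{r_1} ⋯ w_{r_k}`** — so
`(w - 1)V = span{r_i}` («Thus `r_1 ∈ (w - 1)V`. Now choose an `x` … Arguing in this way we see that `r_1, ⋯, r_k ∈ (w - 1)V`»; here by induction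
on the word: for `w' = w_{r_2} ⋯ w_{r_k}`, §2 yields a `w'`-fixed `x` with `⟨x, r_1^∨⟩ ≠ 0`, since `r_1 ∉ span{r_2, …} ⊇ (w' - 1)V`; then
`(w - 1)x ∈ K^× r_1` and `(w - 1)y ≡ (w' - 1)y (mod K r_1)`).
[cite: Carter1972WeylConjugacy, §2 Lemma 3 ("Now suppose conversely that r_1, r_2 … r_k are linearly independent … Thus dim (w - 1)V ≥ k")] -/
theorem root_mem_range_sub_id_of_linearIndependent (l : List ι) (hli : LinearIndependent K (fun j : Fin l.length ↦ P.root l[j])) {i : ι}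
    (hi : i ∈ l) : P.root i ∈ LinearMap.range (DistribSMul.toLinearMap K M (l.map (RootPairing.Equiv.reflection P)).prod - 1) := by
  induction l generalizing i with
  | nil => simp at hi
  | cons a l ih =>
    have hcons : (fun j : Fin (a :: l).length ↦ P.root (a :: l)[j]) = Fin.cons (P.root a) (fun j : Fin l.length ↦ P.root l[j]) := by
      funext j
      rcases j with ⟨_ | j, hj⟩ <;> rfl
    rw [hcons, linearIndependent_finCons, range_root_getElem_eq_image] at hli
    obtain ⟨hli', ha_span⟩ := hli
    have hw' : (l.map (RootPairing.Equiv.reflection P)).prod ∈ P.weylGroup := prod_map_reflection_mem_weylGroup l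
    -- `r_a ∉ (w' - 1)V ⊆ span{r_j : j ∈ l}`, so some `w'`-fixed `x` has `⟨x, r_a^∨⟩ ≠ 0`; then `(w - 1)(-x/⟨x, r_a^∨⟩) = r_a`
    have ha_range : P.root a ∉ LinearMap.range (DistribSMul.toLinearMap K M (l.map (RootPairing.Equiv.reflection P)).prod - 1) :=
      fun h ↦ ha_span (range_sub_id_le_span l h)
    rw [root_mem_range_sub_id_iff_forall_coroot'_eq_zero b hw'] at ha_range
    push Not at ha_range
    obtain ⟨x, hx, hxa⟩ := ha_range
    have ha_mem : P.root a ∈ LinearMap.range (DistribSMul.toLinearMap K M ((a :: l).map (RootPairing.Equiv.reflection P)).prod - 1) := by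
      refine ⟨-(P.coroot' a x)⁻¹ • x, ?_⟩
      rw [toLinearMap_sub_id_apply (P := P), List.map_cons, List.prod_cons, mul_smul,
        smul_comm ((l.map (RootPairing.Equiv.reflection P)).prod) (-(P.coroot' a x)⁻¹) x, hx, RootPairing.Equiv.reflection_smul,
        RootPairing.reflection_apply, sub_sub_cancel_left, map_smul, smul_eq_mul, neg_mul, inv_mul_cancel₀ hxa, neg_smul, one_smul,
        neg_neg]
    rcases List.mem_cons.mp hi with rfl | hi
    · exact ha_mem
    · -- `r_i = (w' - 1)y`, and `(w - 1)y = (w' - 1)y - ⟨w'y, r_a^∨⟩ r_a`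
      obtain ⟨y, hy⟩ := ih hli' hi
      rw [toLinearMap_sub_id_apply (P := P)] at hy
      have h1 : (DistribSMul.toLinearMap K M ((a :: l).map (RootPairing.Equiv.reflection P)).prod - 1) y =
          P.root i - P.coroot' a ((l.map (RootPairing.Equiv.reflection P)).prod • y) • P.root a := by
        rw [toLinearMap_sub_id_apply (P := P), List.map_cons, List.prod_cons, mul_smul, RootPairing.Equiv.reflection_smul,
          RootPairing.reflection_apply, ← hy]
        abel
      have h2 : P.root i = (DistribSMul.toLinearMap K M ((a :: l).map (RootPairing.Equiv.reflection P)).prod - 1) y +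
          P.coroot' a ((l.map (RootPairing.Equiv.reflection P)).prod • y) • P.root a := by
        rw [h1, sub_add_cancel]
      rw [h2]
      exact Submodule.add_mem _ ⟨y, rfl⟩ (Submodule.smul_mem _ _ ha_mem)

include b in
/-- ★★ **CARTER LEMMA 3, ⟸ (counted): for linearly independent roots `r_1, …, r_k`, `dim (w_{r_1} ⋯ w_{r_k} - 1)V = k`** (the expression is reduced).
[cite: Carter1972WeylConjugacy, §2 Lemma 3 ("Thus dim (w - 1)V ≥ k … a contradiction")] -/
theorem finrank_range_sub_id_eq_length_of_linearIndependent [Module.Finite K M] (l : List ι)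
    (hli : LinearIndependent K (fun j : Fin l.length ↦ P.root l[j])) :
    Module.finrank K (LinearMap.range (DistribSMul.toLinearMap K M (l.map (RootPairing.Equiv.reflection P)).prod - 1)) = l.length := by
  refine le_antisymm (finrank_range_sub_id_le_length l) ?_
  have h1 : Module.finrank K (span K (Set.range fun j : Fin l.length ↦ P.root l[j])) = l.length := by
    rw [finrank_span_eq_card hli, Fintype.card_fin]
  rw [← h1, range_root_getElem_eq_image]
  refine Submodule.finrank_mono (Submodule.span_le.mpr ?_)
  rintro _ ⟨i, hi, rfl⟩
  exact root_mem_range_sub_id_of_linearIndependent b l hli hi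

include b in
/-- ★★★ **CARTER 1972 §2 LEMMA 3: `w_{r_1} w_{r_2} ⋯ w_{r_k}` IS REDUCED (`k = l̄(w) = dim (w - 1)V`) IF AND ONLY IF `r_1, r_2, …, r_k` ARE LINEARLY
INDEPENDENT.** [cite: Carter1972WeylConjugacy, §2 Lemma 3 ("Then w_{r_1} w_{r_2} ⋯ w_{r_k} is reduced if and only if r_1, r_2 ⋯ r_k are linearly independent")] -/
theorem finrank_range_sub_id_eq_length_iff_linearIndependent [Module.Finite K M] (l : List ι) :
    Module.finrank K (LinearMap.range (DistribSMul.toLinearMap K M (l.map (RootPairing.Equiv.reflection P)).prod - 1)) = l.length ↔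
      LinearIndependent K (fun j : Fin l.length ↦ P.root l[j]) :=
  ⟨linearIndependent_of_finrank_range_eq_length l, finrank_range_sub_id_eq_length_of_linearIndependent b l⟩

end Base

end Lemma3

end Literature.LinearAlgebra.RootSystem
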